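import Summits.CriticalPhenomena.CardyFormulaZ2.Theorems.CardyUniqueLimitCardyRigidityMvpTestExpansion
import Literature.Analysis.ODE.ViscosityLinearOneDim
import Literature.Analysis.ODE.ViscosityLinearSecondOrder

/-!
# The regularity bootstrap from asymptotic mean-value data (line `crossing-martingale`, crux `CardyRigidity`)

Pure real analysis, theorems only; second file of the ANALYSIS half of the unified stub
`stub_kernelAffineCardy` (crux `CardyRigidity`, stmt-CriticalPhenomena-0746; lead
`prover-line-stmt-CriticalPhenomena-0746-0`).  A continuous kernel `f` on `(0,1)` has *asymptotic
mean-value data at `η₀`* when there are probability measures `ν_n` carried by `[-r_n, r_n]`, `r_n → 0`,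
with `f η₀ = ∫ f(η₀ + x) dν_n` EXACTLY (and `f(η₀ + ·)` integrable), together with moment limits.
Smooth test functions touching `f` from above/below at `η₀` then inherit one-sided inequalities from
the limits of `…MvpTestExpansion` (`touchingAbove_first`, `touchingBelow_first`, `touchingAbove_second`,
`touchingBelow_second`), and the landed viscosity lemmas conclude:

* `const_of_first_order` — if at every point the first moments are `n ∫x dν_n → -c(η₀) m` with
  `c(η₀) > 0` and a common `m ≠ 0`, then `f` is constant on `(0,1)` (`Literature.Analysis.ODE.eq_of_touching`);
* `const_of_second_order_degenerate` — if at every point `n² ∫x dν_n → M₁(η₀) > 0` and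
  `n² ∫x² dν_n → 0`, then `f` is constant on `(0,1)`;
* `contDiffOn_of_second_order` — if at every point `n² ∫x dν_n → B η₀`, `n² ∫x² dν_n → 2 A η₀` with
  `A, B` smooth on `(0,1)` and `A > 0`, then `f` is `C^∞` on `(0,1)`
  (`Literature.Analysis.ODE.contDiffOn_and_ode_of_touching`).
-/

noncomputable section

open MeasureTheory Filter Set Topology
open scoped BigOperators ContDiff

namespace Summit.CriticalPhenomena.CardyFormulaZ2.Cruxes.CardyRigidity.CrossingMartingale

namespace Mvp

variable {f : ℝ → ℝ} {η₀ : ℝ} {ν : ℕ → Measure ℝ} {r : ℕ → ℝ}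

/-! ### Touching test functions inherit one-sided inequalities -/

/-- If `φ` touches `f` from above at `η₀` (`φ η₀ = f η₀`, `f ≤ φ` near `η₀`) then, against mean-value
data at `η₀`, eventually `0 ≤ ∫ φ(η₀ + x) dν_n - φ η₀`. [folklore] -/
theorem eventually_nonneg_of_touchingAbove {φ : ℝ → ℝ} (hφc : Continuous φ) (hφ0 : φ η₀ = f η₀)
    (htouch : ∀ᶠ η in 𝓝 η₀, f η ≤ φ η) (hr : Tendsto r atTop (𝓝 0))
    (hν : ∀ᶠ n in atTop, IsProbabilityMeasure (ν n) ∧ ν n (Icc (-(r n)) (r n))ᶜ = 0)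
    (hid : ∀ᶠ n in atTop, Integrable (fun x ↦ f (η₀ + x)) (ν n) ∧ f η₀ = ∫ x, f (η₀ + x) ∂(ν n)) :
    ∀ᶠ n in atTop, 0 ≤ ∫ x, φ (η₀ + x) ∂(ν n) - φ η₀ := by
  obtain ⟨δ, hδ, hball⟩ := Metric.eventually_nhds_iff.1 htouch
  have hrδ : ∀ᶠ n in atTop, r n < δ := hr.eventually (gt_mem_nhds hδ)
  filter_upwards [hν, hid, hrδ] with n hn hidn hrn
  obtain ⟨hprob, hsupp⟩ := hn
  obtain ⟨hint, hfeq⟩ := hidn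
  have hφint : Integrable (fun x ↦ φ (η₀ + x)) (ν n) :=
    KernelODE.integrable_of_continuous_of_compl_null (hφc.comp (continuous_const.add continuous_id))
      hsupp
  have hle : ∫ x, f (η₀ + x) ∂(ν n) ≤ ∫ x, φ (η₀ + x) ∂(ν n) := by
    refine integral_mono_ae hint hφint ?_
    filter_upwards [KernelODE.ae_mem_Icc_of_compl_null hsupp] with x hx
    refine hball ?_
    rw [Real.dist_eq, add_sub_cancel_left, abs_lt]
    constructor <;> linarith [hx.1, hx.2]
  rw [hφ0, hfeq]
  linarith

/-- Touching from below: eventually `∫ φ(η₀ + x) dν_n - φ η₀ ≤ 0`. [folklore] -/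
theorem eventually_nonpos_of_touchingBelow {φ : ℝ → ℝ} (hφc : Continuous φ) (hφ0 : φ η₀ = f η₀)
    (htouch : ∀ᶠ η in 𝓝 η₀, φ η ≤ f η) (hr : Tendsto r atTop (𝓝 0))
    (hν : ∀ᶠ n in atTop, IsProbabilityMeasure (ν n) ∧ ν n (Icc (-(r n)) (r n))ᶜ = 0)
    (hid : ∀ᶠ n in atTop, Integrable (fun x ↦ f (η₀ + x)) (ν n) ∧ f η₀ = ∫ x, f (η₀ + x) ∂(ν n)) :
    ∀ᶠ n in atTop, ∫ x, φ (η₀ + x) ∂(ν n) - φ η₀ ≤ 0 := by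
  obtain ⟨δ, hδ, hball⟩ := Metric.eventually_nhds_iff.1 htouch
  have hrδ : ∀ᶠ n in atTop, r n < δ := hr.eventually (gt_mem_nhds hδ)
  filter_upwards [hν, hid, hrδ] with n hn hidn hrn
  obtain ⟨hprob, hsupp⟩ := hn
  obtain ⟨hint, hfeq⟩ := hidn
  have hφint : Integrable (fun x ↦ φ (η₀ + x)) (ν n) :=
    KernelODE.integrable_of_continuous_of_compl_null (hφc.comp (continuous_const.add continuous_id))
      hsupp
  have hle : ∫ x, φ (η₀ + x) ∂(ν n) ≤ ∫ x, f (η₀ + x) ∂(ν n) := by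
    refine integral_mono_ae hφint hint ?_
    filter_upwards [KernelODE.ae_mem_Icc_of_compl_null hsupp] with x hx
    refine hball ?_
    rw [Real.dist_eq, add_sub_cancel_left, abs_lt]
    constructor <;> linarith [hx.1, hx.2]
  rw [hφ0, hfeq]
  linarith

/-- **First order, from above**: `0 ≤ φ'(η₀) L₁`. [folklore] -/
theorem touchingAbove_first {φ : ℝ → ℝ} (hφ : ContDiff ℝ ∞ φ) (hφ0 : φ η₀ = f η₀)
    (htouch : ∀ᶠ η in 𝓝 η₀, f η ≤ φ η) (hr : Tendsto r atTop (𝓝 0))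
    (hν : ∀ᶠ n in atTop, IsProbabilityMeasure (ν n) ∧ ν n (Icc (-(r n)) (r n))ᶜ = 0)
    (hid : ∀ᶠ n in atTop, Integrable (fun x ↦ f (η₀ + x)) (ν n) ∧ f η₀ = ∫ x, f (η₀ + x) ∂(ν n))
    {L₁ L₂ : ℝ} (h1 : Tendsto (fun n : ℕ ↦ (n : ℝ) * ∫ x, x ∂(ν n)) atTop (𝓝 L₁))
    (h2 : Tendsto (fun n : ℕ ↦ (n : ℝ) ^ 2 * ∫ x, x ^ 2 ∂(ν n)) atTop (𝓝 L₂)) :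
    0 ≤ deriv φ η₀ * L₁ := by
  refine ge_of_tendsto (tendsto_first_order_of_contDiff (η := η₀) hφ hr hν h1 h2) ?_
  filter_upwards [eventually_nonneg_of_touchingAbove hφ.continuous hφ0 htouch hr hν hid] with n hn
  exact mul_nonneg (Nat.cast_nonneg n) hn

/-- **First order, from below**: `φ'(η₀) L₁ ≤ 0`. [folklore] -/
theorem touchingBelow_first {φ : ℝ → ℝ} (hφ : ContDiff ℝ ∞ φ) (hφ0 : φ η₀ = f η₀)
    (htouch : ∀ᶠ η in 𝓝 η₀, φ η ≤ f η) (hr : Tendsto r atTop (𝓝 0))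
    (hν : ∀ᶠ n in atTop, IsProbabilityMeasure (ν n) ∧ ν n (Icc (-(r n)) (r n))ᶜ = 0)
    (hid : ∀ᶠ n in atTop, Integrable (fun x ↦ f (η₀ + x)) (ν n) ∧ f η₀ = ∫ x, f (η₀ + x) ∂(ν n))
    {L₁ L₂ : ℝ} (h1 : Tendsto (fun n : ℕ ↦ (n : ℝ) * ∫ x, x ∂(ν n)) atTop (𝓝 L₁))
    (h2 : Tendsto (fun n : ℕ ↦ (n : ℝ) ^ 2 * ∫ x, x ^ 2 ∂(ν n)) atTop (𝓝 L₂)) :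
    deriv φ η₀ * L₁ ≤ 0 := by
  refine le_of_tendsto (tendsto_first_order_of_contDiff (η := η₀) hφ hr hν h1 h2) ?_
  filter_upwards [eventually_nonpos_of_touchingBelow hφ.continuous hφ0 htouch hr hν hid] with n hn
  exact mul_nonpos_of_nonneg_of_nonpos (Nat.cast_nonneg n) hn

/-- **Second order, from above**: `0 ≤ φ'(η₀) M₁ + (φ''(η₀)/2) L₂`. [folklore] -/
theorem touchingAbove_second {φ : ℝ → ℝ} (hφ : ContDiff ℝ ∞ φ) (hφ0 : φ η₀ = f η₀)
    (htouch : ∀ᶠ η in 𝓝 η₀, f η ≤ φ η) (hr : Tendsto r atTop (𝓝 0))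
    (hν : ∀ᶠ n in atTop, IsProbabilityMeasure (ν n) ∧ ν n (Icc (-(r n)) (r n))ᶜ = 0)
    (hid : ∀ᶠ n in atTop, Integrable (fun x ↦ f (η₀ + x)) (ν n) ∧ f η₀ = ∫ x, f (η₀ + x) ∂(ν n))
    {M₁ L₂ : ℝ} (h1 : Tendsto (fun n : ℕ ↦ (n : ℝ) ^ 2 * ∫ x, x ∂(ν n)) atTop (𝓝 M₁))
    (h2 : Tendsto (fun n : ℕ ↦ (n : ℝ) ^ 2 * ∫ x, x ^ 2 ∂(ν n)) atTop (𝓝 L₂)) :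
    0 ≤ deriv φ η₀ * M₁ + deriv (deriv φ) η₀ / 2 * L₂ := by
  refine ge_of_tendsto (tendsto_second_order_of_contDiff (η := η₀) hφ hr hν h1 h2) ?_
  filter_upwards [eventually_nonneg_of_touchingAbove hφ.continuous hφ0 htouch hr hν hid] with n hn
  exact mul_nonneg (sq_nonneg _) hn

/-- **Second order, from below**: `φ'(η₀) M₁ + (φ''(η₀)/2) L₂ ≤ 0`. [folklore] -/
theorem touchingBelow_second {φ : ℝ → ℝ} (hφ : ContDiff ℝ ∞ φ) (hφ0 : φ η₀ = f η₀)
    (htouch : ∀ᶠ η in 𝓝 η₀, φ η ≤ f η) (hr : Tendsto r atTop (𝓝 0))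
    (hν : ∀ᶠ n in atTop, IsProbabilityMeasure (ν n) ∧ ν n (Icc (-(r n)) (r n))ᶜ = 0)
    (hid : ∀ᶠ n in atTop, Integrable (fun x ↦ f (η₀ + x)) (ν n) ∧ f η₀ = ∫ x, f (η₀ + x) ∂(ν n))
    {M₁ L₂ : ℝ} (h1 : Tendsto (fun n : ℕ ↦ (n : ℝ) ^ 2 * ∫ x, x ∂(ν n)) atTop (𝓝 M₁))
    (h2 : Tendsto (fun n : ℕ ↦ (n : ℝ) ^ 2 * ∫ x, x ^ 2 ∂(ν n)) atTop (𝓝 L₂)) :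
    deriv φ η₀ * M₁ + deriv (deriv φ) η₀ / 2 * L₂ ≤ 0 := by
  refine le_of_tendsto (tendsto_second_order_of_contDiff (η := η₀) hφ hr hν h1 h2) ?_
  filter_upwards [eventually_nonpos_of_touchingBelow hφ.continuous hφ0 htouch hr hν hid] with n hn
  exact mul_nonpos_of_nonneg_of_nonpos (sq_nonneg _) hn

/-! ### Consequences: constancy and smoothness of the kernel -/

/-- **First-order rigidity.**  If at every point of `(0,1)` the kernel has mean-value data whose
first moments are `n ∫x dν_n → -c(η₀) m` with `c(η₀) > 0` and one common `m ≠ 0`, then `f` is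
constant on `(0,1)`. [folklore] -/
theorem const_of_first_order (hf : ContinuousOn f (Ioo 0 1)) {m : ℝ} (hm : m ≠ 0)
    (hdat : ∀ η₀ ∈ Ioo (0 : ℝ) 1, ∃ (c L₂ : ℝ) (r : ℕ → ℝ) (ν : ℕ → Measure ℝ), 0 < c ∧
      Tendsto r atTop (𝓝 0) ∧
      (∀ᶠ n in atTop, IsProbabilityMeasure (ν n) ∧ ν n (Icc (-(r n)) (r n))ᶜ = 0) ∧
      (∀ᶠ n in atTop, Integrable (fun x ↦ f (η₀ + x)) (ν n) ∧ f η₀ = ∫ x, f (η₀ + x) ∂(ν n)) ∧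
      Tendsto (fun n : ℕ ↦ (n : ℝ) * ∫ x, x ∂(ν n)) atTop (𝓝 (-c * m)) ∧
      Tendsto (fun n : ℕ ↦ (n : ℝ) ^ 2 * ∫ x, x ^ 2 ∂(ν n)) atTop (𝓝 L₂)) :
    ∀ x ∈ Ioo (0 : ℝ) 1, ∀ y ∈ Ioo (0 : ℝ) 1, f x = f y := by
  refine Literature.Analysis.ODE.eq_of_touching hm hf (fun η₀ hη₀ φ hφ hφ0 htouch ↦ ?_)
    (fun η₀ hη₀ φ hφ hφ0 htouch ↦ ?_)
  · obtain ⟨c, L₂, r, ν, hc, hr, hν, hid, h1, h2⟩ := hdat η₀ hη₀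
    have h := touchingAbove_first hφ hφ0 htouch hr hν hid h1 h2
    -- `0 ≤ φ' (-c m)` gives `m φ' ≤ 0`
    have h' : c * (m * deriv φ η₀) ≤ c * 0 := by nlinarith [h]
    exact le_of_mul_le_mul_left h' hc
  · obtain ⟨c, L₂, r, ν, hc, hr, hν, hid, h1, h2⟩ := hdat η₀ hη₀
    have h := touchingBelow_first hφ hφ0 htouch hr hν hid h1 h2
    have h' : c * 0 ≤ c * (m * deriv φ η₀) := by nlinarith [h]
    exact le_of_mul_le_mul_left h' hc

/-- **Degenerate second order is first order again.**  If at every point of `(0,1)` the kernel has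
mean-value data with `n² ∫x dν_n → M₁(η₀) > 0` and `n² ∫x² dν_n → 0`, then `f` is constant on `(0,1)`.
[folklore] -/
theorem const_of_second_order_degenerate (hf : ContinuousOn f (Ioo 0 1))
    (hdat : ∀ η₀ ∈ Ioo (0 : ℝ) 1, ∃ (M₁ : ℝ) (r : ℕ → ℝ) (ν : ℕ → Measure ℝ), 0 < M₁ ∧
      Tendsto r atTop (𝓝 0) ∧
      (∀ᶠ n in atTop, IsProbabilityMeasure (ν n) ∧ ν n (Icc (-(r n)) (r n))ᶜ = 0) ∧
      (∀ᶠ n in atTop, Integrable (fun x ↦ f (η₀ + x)) (ν n) ∧ f η₀ = ∫ x, f (η₀ + x) ∂(ν n)) ∧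
      Tendsto (fun n : ℕ ↦ (n : ℝ) ^ 2 * ∫ x, x ∂(ν n)) atTop (𝓝 M₁) ∧
      Tendsto (fun n : ℕ ↦ (n : ℝ) ^ 2 * ∫ x, x ^ 2 ∂(ν n)) atTop (𝓝 0)) :
    ∀ x ∈ Ioo (0 : ℝ) 1, ∀ y ∈ Ioo (0 : ℝ) 1, f x = f y := by
  refine Literature.Analysis.ODE.eq_of_touching (c := -1) (by norm_num) hf
    (fun η₀ hη₀ φ hφ hφ0 htouch ↦ ?_) (fun η₀ hη₀ φ hφ hφ0 htouch ↦ ?_)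
  · obtain ⟨M₁, r, ν, hM, hr, hν, hid, h1, h2⟩ := hdat η₀ hη₀
    have h := touchingAbove_second hφ hφ0 htouch hr hν hid h1 h2
    rw [mul_zero, add_zero] at h
    have : 0 ≤ deriv φ η₀ := nonneg_of_mul_nonneg_left h hM
    linarith
  · obtain ⟨M₁, r, ν, hM, hr, hν, hid, h1, h2⟩ := hdat η₀ hη₀
    have h := touchingBelow_second hφ hφ0 htouch hr hν hid h1 h2
    rw [mul_zero, add_zero] at h
    have : deriv φ η₀ ≤ 0 := nonpos_of_mul_nonpos_left h hM
    linarith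

/-- **Second-order regularity.**  If at every point of `(0,1)` the kernel has mean-value data with
`n² ∫x dν_n → B η₀` and `n² ∫x² dν_n → 2 A η₀`, where `A, B` are smooth on `(0,1)` and `A > 0`, then
`f` is `C^∞` on `(0,1)` (and solves `A f'' + B f' = 0`): `f` is a viscosity solution of the linear
equation, and `Literature.Analysis.ODE.contDiffOn_and_ode_of_touching` applies. [folklore] -/
theorem contDiffOn_of_second_order (hf : ContinuousOn f (Ioo 0 1)) {A B : ℝ → ℝ}
    (hA : ContDiffOn ℝ ∞ A (Ioo 0 1)) (hB : ContDiffOn ℝ ∞ B (Ioo 0 1))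
    (hpos : ∀ η ∈ Ioo (0 : ℝ) 1, 0 < A η)
    (hdat : ∀ η₀ ∈ Ioo (0 : ℝ) 1, ∃ (r : ℕ → ℝ) (ν : ℕ → Measure ℝ),
      Tendsto r atTop (𝓝 0) ∧
      (∀ᶠ n in atTop, IsProbabilityMeasure (ν n) ∧ ν n (Icc (-(r n)) (r n))ᶜ = 0) ∧
      (∀ᶠ n in atTop, Integrable (fun x ↦ f (η₀ + x)) (ν n) ∧ f η₀ = ∫ x, f (η₀ + x) ∂(ν n)) ∧
      Tendsto (fun n : ℕ ↦ (n : ℝ) ^ 2 * ∫ x, x ∂(ν n)) atTop (𝓝 (B η₀)) ∧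
      Tendsto (fun n : ℕ ↦ (n : ℝ) ^ 2 * ∫ x, x ^ 2 ∂(ν n)) atTop (𝓝 (2 * A η₀))) :
    ContDiffOn ℝ ∞ f (Ioo 0 1) ∧
      ∀ η ∈ Ioo (0 : ℝ) 1, A η * deriv (deriv f) η + B η * deriv f η = 0 := by
  refine Literature.Analysis.ODE.contDiffOn_and_ode_of_touching hf hA hB hpos
    (fun η₀ hη₀ φ hφ hφ0 htouch ↦ ?_) (fun η₀ hη₀ φ hφ hφ0 htouch ↦ ?_)
  · obtain ⟨r, ν, hr, hν, hid, h1, h2⟩ := hdat η₀ hη₀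
    have h := touchingAbove_second hφ hφ0 htouch hr hν hid h1 h2
    have e : deriv φ η₀ * B η₀ + deriv (deriv φ) η₀ / 2 * (2 * A η₀) =
        A η₀ * deriv (deriv φ) η₀ + B η₀ * deriv φ η₀ := by ring
    linarith [e]
  · obtain ⟨r, ν, hr, hν, hid, h1, h2⟩ := hdat η₀ hη₀
    have h := touchingBelow_second hφ hφ0 htouch hr hν hid h1 h2
    have e : deriv φ η₀ * B η₀ + deriv (deriv φ) η₀ / 2 * (2 * A η₀) =
        A η₀ * deriv (deriv φ) η₀ + B η₀ * deriv φ η₀ := by ring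
    linarith [e]

/-! ### The per-point identity for a smooth kernel -/

/-- **Exact identities for a smooth kernel.**  If `f` is `C^∞` on `(0,1)` and has mean-value data at
`η₀ ∈ (0,1)` with `n² ∫x dν_n → M₁`, `n² ∫x² dν_n → L₂`, then
`f'(η₀) M₁ + (f''(η₀)/2) L₂ = 0` (replace `f` near `η₀` by a global smooth `φ`; then
`∫ φ(η₀+x) dν_n = f η₀ = φ η₀` eventually, so the second-order limit vanishes). [folklore] -/
theorem identity_of_contDiffOn (hfs : ContDiffOn ℝ ∞ f (Ioo 0 1)) (hη₀ : η₀ ∈ Ioo (0 : ℝ) 1)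
    (hr : Tendsto r atTop (𝓝 0))
    (hν : ∀ᶠ n in atTop, IsProbabilityMeasure (ν n) ∧ ν n (Icc (-(r n)) (r n))ᶜ = 0)
    (hid : ∀ᶠ n in atTop, Integrable (fun x ↦ f (η₀ + x)) (ν n) ∧ f η₀ = ∫ x, f (η₀ + x) ∂(ν n))
    {M₁ L₂ : ℝ} (h1 : Tendsto (fun n : ℕ ↦ (n : ℝ) ^ 2 * ∫ x, x ∂(ν n)) atTop (𝓝 M₁))
    (h2 : Tendsto (fun n : ℕ ↦ (n : ℝ) ^ 2 * ∫ x, x ^ 2 ∂(ν n)) atTop (𝓝 L₂)) :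
    deriv f η₀ * M₁ + deriv (deriv f) η₀ / 2 * L₂ = 0 := by
  -- a global smooth `φ` agreeing with `f` near `η₀`
  obtain ⟨φ, hφ, hφf⟩ := Literature.Analysis.ODE.exists_contDiff_eventuallyEq
    (Ioo_mem_nhds hη₀.1 hη₀.2) hfs
  have hφ0 : φ η₀ = f η₀ := hφf.eq_of_nhds
  -- eventually the integrals of `φ(η₀ + ·)` and `f(η₀ + ·)` agree
  obtain ⟨δ, hδ, hball⟩ := Metric.eventually_nhds_iff.1 hφf
  have hrδ : ∀ᶠ n in atTop, r n < δ := hr.eventually (gt_mem_nhds hδ)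
  have hzero : ∀ᶠ n : ℕ in atTop, (n : ℝ) ^ 2 * (∫ x, φ (η₀ + x) ∂(ν n) - φ η₀) = 0 := by
    filter_upwards [hν, hid, hrδ] with n hn hidn hrn
    obtain ⟨hprob, hsupp⟩ := hn
    obtain ⟨-, hfeq⟩ := hidn
    have hcongr : ∫ x, φ (η₀ + x) ∂(ν n) = ∫ x, f (η₀ + x) ∂(ν n) := by
      refine integral_congr_ae ?_
      filter_upwards [KernelODE.ae_mem_Icc_of_compl_null hsupp] with x hx
      refine hball ?_
      rw [Real.dist_eq, add_sub_cancel_left, abs_lt]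
      constructor <;> linarith [hx.1, hx.2]
    rw [hcongr, ← hfeq, hφ0, sub_self, mul_zero]
  have hlim := tendsto_second_order_of_contDiff (η := η₀) hφ hr hν h1 h2
  have hlim0 : Tendsto (fun n : ℕ ↦ (n : ℝ) ^ 2 * (∫ x, φ (η₀ + x) ∂(ν n) - φ η₀)) atTop (𝓝 0) :=
    tendsto_const_nhds.congr' (hzero.mono fun n hn ↦ hn.symm)
  have heq := tendsto_nhds_unique hlim hlim0
  -- the derivatives of `φ` at `η₀` are those of `f`
  have hd1 : deriv φ η₀ = deriv f η₀ := hφf.deriv_eq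
  have hd2 : deriv (deriv φ) η₀ = deriv (deriv f) η₀ := by
    have : deriv φ =ᶠ[𝓝 η₀] deriv f := hφf.deriv
    exact this.deriv_eq
  rw [hd1, hd2] at heq
  exact heq

/-- **Registered form** (glue sub-goal `mvp_contDiffOn_of_second_order` of stmt-CriticalPhenomena-0746):
second-order asymptotic mean-value data with smooth coefficients `A > 0`, `B` make a continuous kernel
`C^∞` on `(0,1)`. [folklore] -/
theorem mvp_contDiffOn_of_second_order : ∀ {f : ℝ → ℝ}, ContinuousOn f (Set.Ioo 0 1) → ∀ {A B : ℝ → ℝ}, ContDiffOn ℝ (⊤ : ℕ∞) A (Set.Ioo 0 1) → ContDiffOn ℝ (⊤ : ℕ∞) B (Set.Ioo 0 1) → (∀ η ∈ Set.Ioo (0 : ℝ) 1, 0 < A η) → (∀ η₀ ∈ Set.Ioo (0 : ℝ) 1, ∃ (r : ℕ → ℝ) (ν : ℕ → MeasureTheory.Measure ℝ), Filter.Tendsto r Filter.atTop (nhds 0) ∧ (∀ᶠ n in Filter.atTop, MeasureTheory.IsProbabilityMeasure (ν n) ∧ ν n (Set.Icc (-(r n)) (r n))ᶜ = 0) ∧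 (∀ᶠ n in Filter.atTop, MeasureTheory.Integrable (fun x ↦ f (η₀ + x)) (ν n) ∧ f η₀ = ∫ x, f (η₀ + x) ∂(ν n)) ∧ Filter.Tendsto (fun n : ℕ ↦ (n : ℝ) ^ 2 * ∫ x, x ∂(ν n)) Filter.atTop (nhds (B η₀)) ∧ Filter.Tendsto (fun n : ℕ ↦ (n : ℝ) ^ 2 * ∫ x, x ^ 2 ∂(ν n)) Filter.atTop (nhds (2 * A η₀))) → ContDiffOn ℝ (⊤ : ℕ∞) f (Set.Ioo 0 1) ∧ ∀ η ∈ Set.Ioo (0 : ℝ) 1, A η * deriv (deriv f) η + B η * deriv f η = 0 :=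
  fun hf _ _ hA hB hpos hdat ↦ contDiffOn_of_second_order hf hA hB hpos hdat

end Mvp

end Summit.CriticalPhenomena.CardyFormulaZ2.Cruxes.CardyRigidity.CrossingMartingale

end
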